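import Literature.NumberTheory.Automorphic.OrbitalMeasureCanonicalExistsCM      -- ★ place-type dispatch `compactCore_centralizer_local_facts_of_isRegularElt`, ★ product plumbing, `endoEmbLocal`, `IsLocalGRegular`
import HarnessLib

/-!
# The normalised torus measure on the centraliser of a `G`-regular `γ_H ∈ H_v = U(Φ₂)(L⁺_v) × U(Φ₁)(L⁺_v)` (and of a regular `γ′ ∈ U(H′)(L⁺_v)`):
# `Z(γ_H)` is closed and commutative, its compact core is compact open, and it carries a Haar measure `ρ`, inversion invariant, with `ρ(compactCore) = 1`
# (Rogawski 1990, §4.3 (4.3.1) p. 43 — «compatible measures on `H_{γ′}` and `G_γ`»; Tits 1979 §3.9)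

Topic `NumberTheory/Rogawski1990`; namespace `Literature.NumberTheory.Rogawski1990`.  THEOREMS ONLY (no definition, no named fact, no instance, no notation, no
`sorry`).  Cell `pub/hodgecm-mathlib`, programme P3a, road «D-N6-ns» floor 1, feeder **(o3) «CANONICAL-MEASURE PLUMBING `ρ` on the H-tori `Z_H(t_j)`»** of the
H-side realisation (outside the junction `Rogawski1990/LocalTransferChartJunctionCM.lean`): the `(T) (hTc) (ρ) [IsHaarMeasure ρ] [ρ.IsInvInvariant]
(hρ : ρ (compactCore ↥T) = 1)` binders of ★ `OrbitalMeasureFamily.IsCanonical.exists_isLocSmooth_stableOrbitalIntegralRel_eq_of_chart`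
(`LocalTransferChartRealisationStable` §2) at `G := H_v`, `T := Subgroup.centralizer {t_j}` for a `G`-regular `t_j`.  This is a READ-OFF of ★
`OrbitalMeasureCanonicalExistsCM` (whose `exists_isCanonical_H_local` builds exactly this `ρ` inside its proof): ★ `compactCore_centralizer_local_facts_of_isRegularElt`
on both factors (commutative centraliser, compact core compact and open, every finite place — split or not) + ★ `mul_comm_centralizer_prod` ∕
`isCompact_compactCore_centralizer_prod` ∕ `isOpen_compactCore_centralizer_prod` ∕ `exists_isHaarMeasure_compactCore_centralizer_prod_eq_one`
(`CompactCoreCentralizerUnitary`); the `G`-regularity of `γ_H = (γ₂, γ₁)` gives the regularity of `γ₂` (★ `coe_endoEmbLocal`, ★ `charpoly_endoGL`) and `γ₁ ∈ GL₁` is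
always regular (★ `isRegularElt_of_fin_one`).  HC_CM is proved only modulo the printed citations until rung 0 closes; unconditional plumbing.

* §1 `H_v`: **`compactCore_centralizer_facts_of_isLocalGRegular`** (commutative ∧ compact core compact ∧ open), **`isClosed_centralizer_H_local`**, **`isRegularElt_fst_snd_of_isLocalGRegular`**,
  **`exists_isHaarMeasure_isInvInvariant_compactCore_eq_one`** (`IsClosed ∧ ∃ ρ, IsHaarMeasure ∧ IsInvInvariant ∧ ρ (compactCore) = 1` — F0P2-p02's binder shape).
* §2 `G′_v = U(H′)(L⁺_v)`: the same three heads at a regular `γ′` on the `cmDatum L 3 H′` carrier (`compactCore_centralizer_facts_of_isRegularElt_G`, `isClosed_centralizer_cmDatum_local`, `exists_isHaarMeasure_isInvInvariant_compactCore_eq_one_G`), over ★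
  `forall_isRegularElt_exists_isHaarMeasure_compactCore_centralizer_local_eq_one`.

## References
* [Rogawski1990] J. D. Rogawski, *Automorphic Representations of Unitary Groups in Three Variables*, Ann. of Math. Stud. 123 (1990), §4.3 (4.3.1) p. 43, §1.7 p. 6,
  §4.9 Prop. 4.9.1 (a) p. 55.
* [Tits1979] J. Tits, *Reductive groups over local fields*, Proc. Sympos. Pure Math. 33 (1979), §3.9.
* [DeitmarEchterhoff2014] A. Deitmar, S. Echterhoff, *Principles of Harmonic Analysis*, 2nd ed. (2014), Thm. 1.5.3.
-/

set_option autoImplicit false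

noncomputable section

open MeasureTheory Measure Set Filter Topology NumberField IsDedekindDomain
open scoped ENNReal NNReal Matrix MatrixGroups

namespace Literature.NumberTheory.Rogawski1990

open Literature.NumberTheory.Automorphic Literature.NumberTheory.Automorphic.UnitaryGroup

/-! ## §1 The `H`-tori `Z_H(γ_H)`, `γ_H` `G`-regular -/

section CMH

variable (L : Type) [Field L] [NumberField L] [IsCMField L] (v : HeightOneSpectrum (𝓞 ↥(maximalRealSubfield L)))

omit [IsCMField L] in
/-- `Φ₂ = antidiag(1,1)` has unit determinant. [cite: Rogawski1990, §4.9 p. 54] -/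
private theorem isUnit_det_antidiagTwo : IsUnit (Matrix.of fun i j : Fin 2 => if i.val + j.val + 1 = 2 then (1 : L) else 0).det := by
  have h : (Matrix.of fun i j : Fin 2 => if i.val + j.val + 1 = 2 then (1 : L) else 0) = !![0, 1; 1, 0] := by
    ext i j; fin_cases i <;> fin_cases j <;> rfl
  rw [h, Matrix.det_fin_two_of]; norm_num

omit [IsCMField L] in
/-- `Φ₁ = (1)` has unit determinant. [cite: Rogawski1990, §4.9 p. 54] -/
private theorem isUnit_det_antidiagOne' : IsUnit (Matrix.of fun i j : Fin 1 => if i.val + j.val + 1 = 1 then (1 : L) else 0).det := by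
  rw [Matrix.det_fin_one, Matrix.of_apply]; norm_num

/-- A `G`-regular `γ_H = (γ₂, γ₁)` has `γ₂` regular semisimple in `GL₂(E_v)` (`charpoly ι(γ_H) = charpoly γ₂ · (X − γ₁)` separable) and `γ₁ ∈ GL₁` regular.
[cite: Rogawski1990, §4.3 p. 42] -/
theorem isRegularElt_fst_snd_of_isLocalGRegular
    (γH : (UnitaryGroup.cmDatum L 2 (Matrix.of fun i j : Fin 2 => if i.val + j.val + 1 = 2 then (1 : L) else 0)).Local v ×
      (UnitaryGroup.cmDatum L 1 (Matrix.of fun i j : Fin 1 => if i.val + j.val + 1 = 1 then (1 : L) else 0)).Local v)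
    (hγH : IsLocalGRegular L v γH) :
    IsRegularElt (γH.1.val : GL (Fin 2) (UnitaryGroup.LocalRing L v)) ∧ IsRegularElt (γH.2.val : GL (Fin 1) (UnitaryGroup.LocalRing L v)) := by
  obtain ⟨γ₂, γ₁⟩ := γH
  have h3 : IsRegularElt ((endoEmbLocal L v (γ₂, γ₁)).val : GL (Fin 3) (UnitaryGroup.LocalRing L v)) := hγH
  rw [isRegularElt_iff, coe_endoEmbLocal, charpoly_endoGL] at h3
  exact ⟨h3.of_mul_left, isRegularElt_of_fin_one _⟩

/-- **The three compact-core facts for `Z_H(γ_H)`, `γ_H` `G`-regular** (every finite `v`): the centraliser of `γ_H` in `H_v` is COMMUTATIVE and its compact core is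
COMPACT and OPEN (★ `compactCore_centralizer_local_facts_of_isRegularElt` on both factors + ★ product plumbing). [cite: Rogawski1990, §4.3 (4.3.1) p. 43] [cite: Tits1979, §3.9] -/
theorem compactCore_centralizer_facts_of_isLocalGRegular
    (γH : (UnitaryGroup.cmDatum L 2 (Matrix.of fun i j : Fin 2 => if i.val + j.val + 1 = 2 then (1 : L) else 0)).Local v ×
      (UnitaryGroup.cmDatum L 1 (Matrix.of fun i j : Fin 1 => if i.val + j.val + 1 = 1 then (1 : L) else 0)).Local v)
    (hγH : IsLocalGRegular L v γH) :
    (∀ z z' : Subgroup.centralizer ({γH} : Set _), z * z' = z' * z) ∧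
      IsCompact (compactCore (Subgroup.centralizer ({γH} : Set _))) ∧ IsOpen (compactCore (Subgroup.centralizer ({γH} : Set _))) := by
  obtain ⟨h₂, h₁⟩ := isRegularElt_fst_snd_of_isLocalGRegular L v γH hγH
  obtain ⟨γ₂, γ₁⟩ := γH
  have hΦ₂ := antidiagOne_map_transpose (IsCMField.complexConj L) 2
  have hΦ₁ := antidiagOne_map_transpose (IsCMField.complexConj L) 1
  have f₂ := compactCore_centralizer_local_facts_of_isRegularElt (IsCMField.complexConj L) 2 _ (IsCMField.complexConj_ne_one L) hΦ₂
    (isUnit_det_antidiagTwo L) γ₂ h₂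
  have f₁ := compactCore_centralizer_local_facts_of_isRegularElt (IsCMField.complexConj L) 1 _ (IsCMField.complexConj_ne_one L) hΦ₁
    (isUnit_det_antidiagOne' L) γ₁ h₁
  exact ⟨mul_comm_centralizer_prod
      (A := (UnitaryGroup.cmDatum L 2 (Matrix.of fun i j : Fin 2 => if i.val + j.val + 1 = 2 then (1 : L) else 0)).Local v)
      (B := (UnitaryGroup.cmDatum L 1 (Matrix.of fun i j : Fin 1 => if i.val + j.val + 1 = 1 then (1 : L) else 0)).Local v) γ₂ γ₁ f₂.1 f₁.1,
    isCompact_compactCore_centralizer_prod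
      (A := (UnitaryGroup.cmDatum L 2 (Matrix.of fun i j : Fin 2 => if i.val + j.val + 1 = 2 then (1 : L) else 0)).Local v)
      (B := (UnitaryGroup.cmDatum L 1 (Matrix.of fun i j : Fin 1 => if i.val + j.val + 1 = 1 then (1 : L) else 0)).Local v) γ₂ γ₁ f₂.2.1 f₁.2.1,
    isOpen_compactCore_centralizer_prod
      (A := (UnitaryGroup.cmDatum L 2 (Matrix.of fun i j : Fin 2 => if i.val + j.val + 1 = 2 then (1 : L) else 0)).Local v)
      (B := (UnitaryGroup.cmDatum L 1 (Matrix.of fun i j : Fin 1 => if i.val + j.val + 1 = 1 then (1 : L) else 0)).Local v) γ₂ γ₁ f₂.2.2 f₁.2.2⟩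

/-- **`Z_H(γ_H)` is closed** in `H_v` (any element; `H_v` is Hausdorff with continuous multiplication). [cite: Rogawski1990, §4.3 (4.3.1) p. 43] -/
theorem isClosed_centralizer_H_local
    (γH : (UnitaryGroup.cmDatum L 2 (Matrix.of fun i j : Fin 2 => if i.val + j.val + 1 = 2 then (1 : L) else 0)).Local v ×
      (UnitaryGroup.cmDatum L 1 (Matrix.of fun i j : Fin 1 => if i.val + j.val + 1 = 1 then (1 : L) else 0)).Local v) :
    IsClosed ((Subgroup.centralizer ({γH} : Set _) : Subgroup _) : Set
      ((UnitaryGroup.cmDatum L 2 (Matrix.of fun i j : Fin 2 => if i.val + j.val + 1 = 2 then (1 : L) else 0)).Local v ×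
        (UnitaryGroup.cmDatum L 1 (Matrix.of fun i j : Fin 1 => if i.val + j.val + 1 = 1 then (1 : L) else 0)).Local v)) :=
  Set.isClosed_centralizer _

/-- **THE NORMALISED TORUS MEASURE ON `Z_H(γ_H)`** (every finite `v`, `γ_H` `G`-regular): `Z_H(γ_H)` is CLOSED, and carries a Haar measure `ρ` which is
INVERSION INVARIANT and has `ρ (compactCore Z_H(γ_H)) = 1` — the `(T, hTc, ρ, hρ)` input of ★ `IsCanonical.exists_isLocSmooth_stableOrbitalIntegralRel_eq_of_chart`
at `T := Z_H(γ_H)` (★ `exists_isHaarMeasure_compactCore_centralizer_prod_eq_one` on the facts above).  Print: «the orbital integrals are defined using compatible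
measures on `H_{γ′}` and `G_γ`» [§4.3]; our normalisation is mass one on the compact core (★ `OrbitalMeasureFamily.IsCanonical`).
[cite: Rogawski1990, §4.3 (4.3.1) p. 43; §1.7 p. 6] [cite: Tits1979, §3.9] [cite: DeitmarEchterhoff2014, Thm. 1.5.3] -/
theorem exists_isHaarMeasure_isInvInvariant_compactCore_eq_one
    [MeasurableSpace ((UnitaryGroup.cmDatum L 2 (Matrix.of fun i j : Fin 2 => if i.val + j.val + 1 = 2 then (1 : L) else 0)).Local v ×
      (UnitaryGroup.cmDatum L 1 (Matrix.of fun i j : Fin 1 => if i.val + j.val + 1 = 1 then (1 : L) else 0)).Local v)]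
    [BorelSpace ((UnitaryGroup.cmDatum L 2 (Matrix.of fun i j : Fin 2 => if i.val + j.val + 1 = 2 then (1 : L) else 0)).Local v ×
      (UnitaryGroup.cmDatum L 1 (Matrix.of fun i j : Fin 1 => if i.val + j.val + 1 = 1 then (1 : L) else 0)).Local v)]
    (γH : (UnitaryGroup.cmDatum L 2 (Matrix.of fun i j : Fin 2 => if i.val + j.val + 1 = 2 then (1 : L) else 0)).Local v ×
      (UnitaryGroup.cmDatum L 1 (Matrix.of fun i j : Fin 1 => if i.val + j.val + 1 = 1 then (1 : L) else 0)).Local v)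
    (hγH : IsLocalGRegular L v γH) :
    IsClosed ((Subgroup.centralizer ({γH} : Set _) : Subgroup _) : Set
        ((UnitaryGroup.cmDatum L 2 (Matrix.of fun i j : Fin 2 => if i.val + j.val + 1 = 2 then (1 : L) else 0)).Local v ×
          (UnitaryGroup.cmDatum L 1 (Matrix.of fun i j : Fin 1 => if i.val + j.val + 1 = 1 then (1 : L) else 0)).Local v)) ∧
      ∃ ρ : Measure ↥(Subgroup.centralizer ({γH} : Set _)), ρ.IsHaarMeasure ∧ ρ.IsInvInvariant ∧
        ρ (compactCore ↥(Subgroup.centralizer ({γH} : Set _))) = 1 := by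
  refine ⟨isClosed_centralizer_H_local L v γH, ?_⟩
  obtain ⟨h₂, h₁⟩ := isRegularElt_fst_snd_of_isLocalGRegular L v γH hγH
  obtain ⟨γ₂, γ₁⟩ := γH
  have hΦ₂ := antidiagOne_map_transpose (IsCMField.complexConj L) 2
  have hΦ₁ := antidiagOne_map_transpose (IsCMField.complexConj L) 1
  have f₂ := compactCore_centralizer_local_facts_of_isRegularElt (IsCMField.complexConj L) 2 _ (IsCMField.complexConj_ne_one L) hΦ₂
    (isUnit_det_antidiagTwo L) γ₂ h₂
  have f₁ := compactCore_centralizer_local_facts_of_isRegularElt (IsCMField.complexConj L) 1 _ (IsCMField.complexConj_ne_one L) hΦ₁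
    (isUnit_det_antidiagOne' L) γ₁ h₁
  -- pin the factor carriers to the `cmDatum` spellings FIRST (so every instance is the letter's `locGroup ∕ locTop ∕ locTopGroup`), then feed the
  -- `«local»`-spelled facts hole by hole (definitionally the same propositions) — the pattern of ★ `exists_isCanonical_H_local`
  refine exists_isHaarMeasure_compactCore_centralizer_prod_eq_one
    (A := (UnitaryGroup.cmDatum L 2 (Matrix.of fun i j : Fin 2 => if i.val + j.val + 1 = 2 then (1 : L) else 0)).Local v)
    (B := (UnitaryGroup.cmDatum L 1 (Matrix.of fun i j : Fin 1 => if i.val + j.val + 1 = 1 then (1 : L) else 0)).Local v)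
    γ₂ γ₁ ?_ ?_ ?_ ?_ ?_ ?_
  · exact f₂.1
  · exact f₁.1
  · exact f₂.2.1
  · exact f₂.2.2
  · exact f₁.2.1
  · exact f₁.2.2

end CMH

/-! ## §2 The `G′`-tori `Z(γ′)`, `γ′ ∈ U(H′)(L⁺_v)` regular -/

section CMG

variable (L : Type) [Field L] [NumberField L] [IsCMField L] (H' : Matrix (Fin 3) (Fin 3) L) (hH' : (H'.map (IsCMField.complexConj L))ᵀ = H')
  (hH'd : IsUnit H'.det) (v : HeightOneSpectrum (𝓞 ↥(maximalRealSubfield L)))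

include hH' hH'd in
/-- **The three compact-core facts for `Z(γ′) ≤ U(H′)(L⁺_v)`, `γ′` regular semisimple** (every finite `v`), on the `cmDatum` carrier (★
`compactCore_centralizer_local_facts_of_isRegularElt`, definitionally the same group as `«local»`). [cite: Rogawski1990, §4.3 (4.3.1) p. 43] [cite: Tits1979, §3.9] -/
theorem compactCore_centralizer_facts_of_isRegularElt_G (γ : (UnitaryGroup.cmDatum L 3 H').Local v)
    (hγ : IsRegularElt (γ.val : GL (Fin 3) (UnitaryGroup.LocalRing L v))) :
    (∀ z z' : Subgroup.centralizer ({γ} : Set ((UnitaryGroup.cmDatum L 3 H').Local v)), z * z' = z' * z) ∧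
      IsCompact (compactCore (Subgroup.centralizer ({γ} : Set ((UnitaryGroup.cmDatum L 3 H').Local v)))) ∧
        IsOpen (compactCore (Subgroup.centralizer ({γ} : Set ((UnitaryGroup.cmDatum L 3 H').Local v)))) :=
  compactCore_centralizer_local_facts_of_isRegularElt (IsCMField.complexConj L) 3 H' (IsCMField.complexConj_ne_one L) hH' hH'd γ hγ

/-- **`Z(γ′)` is closed** in `U(H′)(L⁺_v)`. [cite: Rogawski1990, §4.3 (4.3.1) p. 43] -/
theorem isClosed_centralizer_cmDatum_local (γ : (UnitaryGroup.cmDatum L 3 H').Local v) :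
    IsClosed ((Subgroup.centralizer ({γ} : Set ((UnitaryGroup.cmDatum L 3 H').Local v)) : Subgroup _) :
      Set ((UnitaryGroup.cmDatum L 3 H').Local v)) :=
  Set.isClosed_centralizer _

include hH' hH'd in
/-- **THE NORMALISED TORUS MEASURE ON `Z(γ′)`**, `γ′ ∈ U(H′)(L⁺_v)` regular semisimple (every finite `v`): `Z(γ′)` is closed and carries a Haar measure, inversion
invariant, with mass `1` on its compact core — the `(T, hTc, ρ, hρ)` input of the `G′`-side realisation heads (★ `forall_isRegularElt_exists_isHaarMeasure_compactCore_centralizer_local_eq_one`).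
[cite: Rogawski1990, §4.3 (4.3.1) p. 43; §1.7 p. 6] [cite: Tits1979, §3.9] -/
theorem exists_isHaarMeasure_isInvInvariant_compactCore_eq_one_G
    [MeasurableSpace ((UnitaryGroup.cmDatum L 3 H').Local v)] [BorelSpace ((UnitaryGroup.cmDatum L 3 H').Local v)]
    (γ : (UnitaryGroup.cmDatum L 3 H').Local v) (hγ : IsRegularElt (γ.val : GL (Fin 3) (UnitaryGroup.LocalRing L v))) :
    IsClosed ((Subgroup.centralizer ({γ} : Set ((UnitaryGroup.cmDatum L 3 H').Local v)) : Subgroup _) :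
        Set ((UnitaryGroup.cmDatum L 3 H').Local v)) ∧
      ∃ ρ : Measure ↥(Subgroup.centralizer ({γ} : Set ((UnitaryGroup.cmDatum L 3 H').Local v))),
        ρ.IsHaarMeasure ∧ ρ.IsInvInvariant ∧ ρ (compactCore ↥(Subgroup.centralizer ({γ} : Set ((UnitaryGroup.cmDatum L 3 H').Local v)))) = 1 := by
  -- the `cmDatum` carrier IS `↥(«local» …)` (★ `exists_isCanonical_cmDatum_local`'s bridging): hand its σ-algebra to the matrix carrier
  letI : MeasurableSpace (UnitaryGroup.«local» L (IsCMField.complexConj L) 3 H' v) := ‹MeasurableSpace ((UnitaryGroup.cmDatum L 3 H').Local v)›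
  haveI : BorelSpace (UnitaryGroup.«local» L (IsCMField.complexConj L) 3 H' v) := ‹BorelSpace ((UnitaryGroup.cmDatum L 3 H').Local v)›
  exact ⟨isClosed_centralizer_cmDatum_local L H' v γ,
    forall_isRegularElt_exists_isHaarMeasure_compactCore_centralizer_local_eq_one (IsCMField.complexConj L) 3 H'
      (IsCMField.complexConj_ne_one L) hH' hH'd γ hγ⟩

end CMG

end Literature.NumberTheory.Rogawski1990

end
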